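import Summits.MatrixMultiplication.MatrixMultiplication.Theses.FourierTwoFamiliesModP
import Literature.Computability.AlgebraicComplexity.SimultaneousDoubleProduct

/-!
# `PrimeTwoFamilies` (crux stmt-MatrixMultiplication-14308): shape diversity and pattern poverty of
# witnesses (the "few shapes" strengthening refuted)

Negative-side support file of the crux disprover (cdisprove seat); everything `sorry`-free.
A witness of slice `δ` is: a prime `p ≤ n^{2+δ}`, `n` SDPP pairs in `ℤ/p` with `|Aᵢ||Bᵢ| ≥ n^{2-δ}`.

* `isSDPP_swap` (SDPP symmetry); `UsesRightShapes B K` (the `B`-sides are translates of `K` templates),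
  `UsesShapes A B K` (two-sided).
* `sum_card_mul_card_le_of_subshape` — A COMMON TRANSLATED SUB-PATTERN PACKS: `u i +ᵥ B₀ ⊆ B i` for all
  `i ∈ S` in an SDPP family ⇒ `(Σ_{i∈S}|Aᵢ|)·|B₀| ≤ |G|` ((X) at `(i,k,k)` + (W)); `…of_rightClass`
  (equality case); `sum_card_mul_le_of_usesRightShapes` / `…LeftShapes` / `…Shapes` (`Σ|Aᵢ||Bᵢ| ≤ K|G|`).
* `rpow_le_rightShapes_of_witness` (`K` right shapes ⇒ `n^{1-2δ} ≤ K`; likewise left / two-sided) and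
  `not_rightShapedPrimeTwoFamiliesAt` — the "few one-sided shapes" strengthening
  `RightShapedPrimeTwoFamiliesAt K δ` is FALSE for every `K` and every `δ < 1/2` (translate designs,
  CKSU's trivial example and all bounded-menu designs are stuck at `δ ≥ 1/2`; sharp by `Translates`).
* `rpow_le_sum_card_mul_of_witness` (Cauchy–Schwarz: `n^{4-δ} ≤ (Σ|Aᵢ|)·p`) and
  `common_subshape_card_le_of_witness` — PATTERN POVERTY: a pattern common to all `Bᵢ` (or all `Aᵢ`)
  of a witness up to translation has size `≤ n^{3δ}`.
-/

namespace Summit.MatrixMultiplication.MatrixMultiplication.Theorems.PrimeTwoFamilies.Negative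

open Finset
open Summit.MatrixMultiplication.MatrixMultiplication.Theses
open Literature.Computability.AlgebraicComplexity

/-! ## §2 Structure of witnesses: shape diversity (refuted strengthening "few shapes") -/

section Shapes
open scoped Pointwise

variable {G : Type*} [AddCommGroup G] [DecidableEq G] {n : ℕ}

omit [DecidableEq G] in
/-- The SDPP is symmetric in its two sides. -/
theorem isSDPP_swap {A B : Fin n → Finset G} (h : IsSDPP A B) : IsSDPP B A := by
  refine ⟨fun i b hb b' hb' a ha a' ha' h0 => ?_, fun i j k b hb b' hb' a ha a' ha' h0 => ?_⟩
  · have e : (a - a') + (b - b') = (b - b') + (a - a') := by abel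
    have := h.1 i a ha a' ha' b hb b' hb' (by rw [e, h0])
    exact ⟨this.2, this.1⟩
  · have e : (a' - a) + (b' - b) = -((b - b') + (a - a')) := by abel
    exact (h.2 k j i a' ha' a ha b' hb' b hb (by rw [e, h0, neg_zero])).symm

/-- The `B`-sides of the family use at most `K` SHAPES: every `B i` is a translate `u i +ᵥ B₀ c`
of one of `K` templates (`A`-sides arbitrary). -/
def UsesRightShapes (B : Fin n → Finset G) (K : ℕ) : Prop :=
  ∃ (B₀ : Fin K → Finset G) (c : Fin n → Fin K) (u : Fin n → G), ∀ i : Fin n, B i = u i +ᵥ B₀ (c i)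

/-- The family `(A i, B i)_{i<n}` uses at most `K` (two-sided) SHAPES: every pair is a translate
`(t i +ᵥ A₀ c, u i +ᵥ B₀ c)` of one of `K` template pairs. -/
def UsesShapes (A B : Fin n → Finset G) (K : ℕ) : Prop :=
  ∃ (A₀ B₀ : Fin K → Finset G) (c : Fin n → Fin K) (t u : Fin n → G),
    ∀ i : Fin n, A i = t i +ᵥ A₀ (c i) ∧ B i = u i +ᵥ B₀ (c i)

/-- Two-sided shapes are in particular right shapes. -/
theorem UsesShapes.right {A B : Fin n → Finset G} {K : ℕ} (h : UsesShapes A B K) :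
    UsesRightShapes B K := by
  obtain ⟨_, B₀, c, _, u, hAB⟩ := h
  exact ⟨B₀, c, u, fun i => (hAB i).2⟩

/-- **A common translated sub-pattern packs**: if a translate `u i +ᵥ B₀` of one pattern `B₀` lies
inside `B i` for every `i ∈ S` (in an SDPP family), then `(a, b) ↦ a + b` is injective on
`(⊔_{i∈S} A i) × B₀` — (X) at `(i, k, k)` separates the blocks (`a - a' = (u_k + b') - (u_k + b)` forces
`i = k`), (W) separates inside a block — so `(Σ_{i∈S} |A i|)·|B₀| ≤ |G|`. -/
theorem sum_card_mul_card_le_of_subshape [Fintype G] {A B : Fin n → Finset G} (h : IsSDPP A B)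
    (S : Finset (Fin n)) (B₀ : Finset G) (u : Fin n → G) (hB : ∀ i ∈ S, u i +ᵥ B₀ ⊆ B i) :
    (∑ i ∈ S, (A i).card) * B₀.card ≤ Fintype.card G := by
  classical
  have memB : ∀ i ∈ S, ∀ b ∈ B₀, u i + b ∈ B i := fun i hi b hb =>
    hB i hi (Finset.mem_vadd_finset.2 ⟨b, hb, rfl⟩)
  let f : (Σ _ : Fin n, G) × G → G := fun x => x.1.2 + x.2
  have hinj : Set.InjOn f ↑((S.sigma fun i => A i) ×ˢ B₀) := by
    rintro ⟨⟨i, a⟩, b⟩ hx ⟨⟨k, a'⟩, b'⟩ hy hxy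
    simp only [Finset.coe_product, Set.mem_prod, Finset.mem_coe, Finset.mem_sigma] at hx hy
    obtain ⟨⟨hi, ha⟩, hb⟩ := hx
    obtain ⟨⟨hk, ha'⟩, hb'⟩ := hy
    simp only [f] at hxy
    have e : ∀ v : G, a - a' + (v + b - (v + b')) = (a + b) - (a' + b') := fun v => by abel
    have hik : i = k :=
      h.2 i k k a ha a' ha' (u k + b) (memB k hk b hb) (u k + b') (memB k hk b' hb')
        (by rw [e, hxy, sub_self])
    subst hik
    obtain ⟨h1, h2⟩ := h.1 i a ha a' ha' (u i + b) (memB i hi b hb) (u i + b') (memB i hi b' hb')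
      (by rw [e, hxy, sub_self])
    have hb2 : b = b' := add_left_cancel h2
    subst h1; subst hb2; rfl
  have := Finset.card_le_card_of_injOn f (fun _ _ => Finset.mem_univ _) hinj
  rwa [Finset.card_product, Finset.card_sigma, Finset.card_univ] at this

/-- **One right class packs** (the case of equality `B i = u i +ᵥ B₀`, `i ∈ S`):
`(Σ_{i∈S} |A i|)·|B₀| ≤ |G|`.  Only the `B`-sides need to be translates of each other. -/
theorem sum_card_mul_card_le_of_rightClass [Fintype G] {A B : Fin n → Finset G} (h : IsSDPP A B)
    (S : Finset (Fin n)) (B₀ : Finset G) (u : Fin n → G) (hB : ∀ i ∈ S, B i = u i +ᵥ B₀) :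
    (∑ i ∈ S, (A i).card) * B₀.card ≤ Fintype.card G :=
  sum_card_mul_card_le_of_subshape h S B₀ u fun i hi => by rw [hB i hi]

/-- **`K` right shapes pack `K` times**: an SDPP family whose `B`-sides use at most `K` shapes has
`Σᵢ |Aᵢ||Bᵢ| ≤ K·|G|`. -/
theorem sum_card_mul_le_of_usesRightShapes [Fintype G] {K : ℕ} {A B : Fin n → Finset G}
    (h : IsSDPP A B) (hK : UsesRightShapes B K) :
    ∑ i, (A i).card * (B i).card ≤ K * Fintype.card G := by
  classical
  obtain ⟨B₀, c, u, hB⟩ := hK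
  have hcard : ∀ i, (B i).card = (B₀ (c i)).card := fun i => by rw [hB i, Finset.card_vadd_finset]
  rw [← Finset.sum_fiberwise (Finset.univ : Finset (Fin n)) c (fun i => (A i).card * (B i).card)]
  have hclass : ∀ k : Fin K,
      ∑ i ∈ (Finset.univ : Finset (Fin n)).filter (fun i => c i = k), (A i).card * (B i).card ≤
        Fintype.card G := by
    intro k
    have h1 : ∑ i ∈ (Finset.univ : Finset (Fin n)).filter (fun i => c i = k), (A i).card * (B i).card =
        (∑ i ∈ (Finset.univ : Finset (Fin n)).filter (fun i => c i = k), (A i).card) * (B₀ k).card := by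
      rw [Finset.sum_mul]
      refine Finset.sum_congr rfl fun i hi => ?_
      rw [Finset.mem_filter] at hi
      rw [hcard i, hi.2]
    rw [h1]
    refine sum_card_mul_card_le_of_rightClass h _ (B₀ k) u fun i hi => ?_
    rw [Finset.mem_filter] at hi
    rw [hB i, hi.2]
  calc ∑ k : Fin K, ∑ i ∈ (Finset.univ : Finset (Fin n)).filter (fun i => c i = k),
        (A i).card * (B i).card
      ≤ ∑ _k : Fin K, Fintype.card G := Finset.sum_le_sum fun k _ => hclass k
    _ = K * Fintype.card G := by
      rw [Finset.sum_const, Finset.card_univ, Fintype.card_fin, smul_eq_mul]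

/-- The same for the `A`-sides (SDPP symmetry). -/
theorem sum_card_mul_le_of_usesLeftShapes [Fintype G] {K : ℕ} {A B : Fin n → Finset G}
    (h : IsSDPP A B) (hK : UsesRightShapes A K) :
    ∑ i, (A i).card * (B i).card ≤ K * Fintype.card G := by
  have := sum_card_mul_le_of_usesRightShapes (isSDPP_swap h) hK
  simpa only [mul_comm] using this

/-- Two-sided version (corollary). -/
theorem sum_card_mul_le_of_usesShapes [Fintype G] {K : ℕ} {A B : Fin n → Finset G}
    (h : IsSDPP A B) (hK : UsesShapes A B K) :
    ∑ i, (A i).card * (B i).card ≤ K * Fintype.card G :=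
  sum_card_mul_le_of_usesRightShapes h hK.right

/-- **Shape diversity of witnesses**: a configuration witnessing slice `δ` at level `n ≥ 1`
(prime `p ≤ n^{2+δ}`, SDPP, `|Aᵢ||Bᵢ| ≥ n^{2-δ}`) whose `B`-sides use at most `K` shapes has
`n^{1-2δ} ≤ K`; by symmetry the same for the `A`-sides.  So witnesses of the crux near `δ → 0`
use `n^{1-o(1)}` pairwise non-translate sets on EACH side. -/
theorem rpow_le_rightShapes_of_witness {n p K : ℕ} (hp : p.Prime) (hn : 1 ≤ n) {δ : ℝ}
    {A B : Fin n → Finset (ZMod p)} (h : IsSDPP A B) (hK : UsesRightShapes B K)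
    (hpn : (p : ℝ) ≤ (n : ℝ) ^ (2 + δ))
    (hAB : ∀ i : Fin n, (n : ℝ) ^ (2 - δ) ≤ (((A i).card * (B i).card : ℕ) : ℝ)) :
    (n : ℝ) ^ (1 - 2 * δ) ≤ K := by
  haveI : Fact p.Prime := ⟨hp⟩
  have hsum := sum_card_mul_le_of_usesRightShapes h hK
  rw [ZMod.card] at hsum
  have hnpos : (0 : ℝ) < n := by exact_mod_cast hn
  have h1 : (n : ℝ) * (n : ℝ) ^ (2 - δ) ≤ (K : ℝ) * (n : ℝ) ^ (2 + δ) := by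
    calc (n : ℝ) * (n : ℝ) ^ (2 - δ) = ∑ _i : Fin n, (n : ℝ) ^ (2 - δ) := by
          rw [Finset.sum_const, Finset.card_univ, Fintype.card_fin, nsmul_eq_mul]
      _ ≤ ∑ i : Fin n, (((A i).card * (B i).card : ℕ) : ℝ) := Finset.sum_le_sum fun i _ => hAB i
      _ = ((∑ i : Fin n, (A i).card * (B i).card : ℕ) : ℝ) := by push_cast; rfl
      _ ≤ ((K * p : ℕ) : ℝ) := by exact_mod_cast hsum
      _ = (K : ℝ) * (p : ℝ) := by push_cast; rfl
      _ ≤ (K : ℝ) * (n : ℝ) ^ (2 + δ) := mul_le_mul_of_nonneg_left hpn (Nat.cast_nonneg K)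
  have h2 : (n : ℝ) * (n : ℝ) ^ (2 - δ) = (n : ℝ) ^ (1 - 2 * δ) * (n : ℝ) ^ (2 + δ) := by
    rw [← Real.rpow_add hnpos, show (1 - 2 * δ + (2 + δ) : ℝ) = 1 + (2 - δ) by ring,
      Real.rpow_add hnpos, Real.rpow_one]
  rw [h2] at h1
  exact le_of_mul_le_mul_right h1 (Real.rpow_pos_of_pos hnpos _)

/-- The `A`-side version of `rpow_le_rightShapes_of_witness`. -/
theorem rpow_le_leftShapes_of_witness {n p K : ℕ} (hp : p.Prime) (hn : 1 ≤ n) {δ : ℝ}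
    {A B : Fin n → Finset (ZMod p)} (h : IsSDPP A B) (hK : UsesRightShapes A K)
    (hpn : (p : ℝ) ≤ (n : ℝ) ^ (2 + δ))
    (hAB : ∀ i : Fin n, (n : ℝ) ^ (2 - δ) ≤ (((A i).card * (B i).card : ℕ) : ℝ)) :
    (n : ℝ) ^ (1 - 2 * δ) ≤ K :=
  rpow_le_rightShapes_of_witness hp hn (isSDPP_swap h) hK hpn
    (fun i => by rw [mul_comm]; exact hAB i)

/-- Two-sided corollary (the v1 statement). -/
theorem rpow_le_shapes_of_witness {n p K : ℕ} (hp : p.Prime) (hn : 1 ≤ n) {δ : ℝ}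
    {A B : Fin n → Finset (ZMod p)} (h : IsSDPP A B) (hK : UsesShapes A B K)
    (hpn : (p : ℝ) ≤ (n : ℝ) ^ (2 + δ))
    (hAB : ∀ i : Fin n, (n : ℝ) ^ (2 - δ) ≤ (((A i).card * (B i).card : ℕ) : ℝ)) :
    (n : ℝ) ^ (1 - 2 * δ) ≤ K :=
  rpow_le_rightShapes_of_witness hp hn h hK.right hpn hAB

/-- The "few right shapes" strengthening of slice `δ`: the slice, witnessed by families whose
`B`-sides use at most `K` shapes (translates of `K` templates; `A`-sides arbitrary). -/
def RightShapedPrimeTwoFamiliesAt (K : ℕ) (δ : ℝ) : Prop :=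
  ∀ n₀ : ℕ, ∃ n ≥ n₀, ∃ p : ℕ, p.Prime ∧ ∃ A B : Fin n → Finset (ZMod p),
    UsesRightShapes B K ∧
    (∀ i : Fin n, ∀ a ∈ A i, ∀ a' ∈ A i, ∀ b ∈ B i, ∀ b' ∈ B i,
        (a - a') + (b - b') = 0 → a = a' ∧ b = b') ∧
    (∀ i j k : Fin n, ∀ a ∈ A i, ∀ a' ∈ A j, ∀ b ∈ B j, ∀ b' ∈ B k,
        (a - a') + (b - b') = 0 → i = k) ∧
    (p : ℝ) ≤ (n : ℝ) ^ (2 + δ) ∧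
    ∀ i : Fin n, (n : ℝ) ^ (2 - δ) ≤ (((A i).card * (B i).card : ℕ) : ℝ)

/-- **No bounded number of (one-sided) shapes reaches below `δ = 1/2`**: for every `K` and every
`δ < 1/2`, `¬ RightShapedPrimeTwoFamiliesAt K δ`.  In particular translate designs (`K = 1`; they do
realise every `δ > 1/2`: `A = [0,s)`, `B = s·[0,s)` shifted by multiples of `s²`), CKSU's trivial
example (`Bᵢ` singletons) and every bounded-menu design are stuck at `δ ≥ 1/2`. -/
theorem not_rightShapedPrimeTwoFamiliesAt (K : ℕ) {δ : ℝ} (hδ : δ < 1 / 2) :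
    ¬ RightShapedPrimeTwoFamiliesAt K δ := by
  intro h
  obtain ⟨n, hn, p, hp, A, B, hK, hW, hX, hpn, hAB⟩ := h (⌈((K : ℝ) + 1) ^ (1 / (1 - 2 * δ))⌉₊ + 1)
  have hn1 : 1 ≤ n := by omega
  have hle := rpow_le_rightShapes_of_witness hp hn1 ⟨hW, hX⟩ hK hpn hAB
  have hexp : 0 < 1 - 2 * δ := by linarith
  have hK1 : (0 : ℝ) ≤ (K : ℝ) + 1 := by positivity
  have hbase : ((K : ℝ) + 1) ^ (1 / (1 - 2 * δ)) < n := by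
    have h1 := Nat.le_ceil (((K : ℝ) + 1) ^ (1 / (1 - 2 * δ)))
    have h2 : (⌈((K : ℝ) + 1) ^ (1 / (1 - 2 * δ))⌉₊ : ℝ) < n := by exact_mod_cast hn
    linarith
  have hlt : (K : ℝ) + 1 < (n : ℝ) ^ (1 - 2 * δ) := by
    have h3 := Real.rpow_lt_rpow (Real.rpow_nonneg hK1 _) hbase hexp
    rwa [← Real.rpow_mul hK1, one_div_mul_cancel hexp.ne', Real.rpow_one] at h3
  linarith

/-! ### §2b Pattern poverty of witnesses -/

/-- **Witness packing lower bound** (Cauchy–Schwarz + pairwise disjointness of the `Bᵢ`): in a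
configuration with `n ≥ 1` SDPP pairs in `ℤ/p` and `|Aᵢ||Bᵢ| ≥ n^{2-δ}` one has
`n^{4-δ} ≤ (Σᵢ |Aᵢ|)·p` — since `n·n^{1-δ/2} ≤ Σ √|Aᵢ|√|Bᵢ| ≤ √(Σ|Aᵢ|)·√(Σ|Bᵢ|)` and `Σ|Bᵢ| ≤ p`.
So `Σ|Aᵢ| ≥ n^{2-2δ}` for witnesses of slice `δ` (and symmetrically for `Σ|Bᵢ|`). -/
theorem rpow_le_sum_card_mul_of_witness {n p : ℕ} (hp : p.Prime) (hn : 1 ≤ n) {δ : ℝ}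
    {A B : Fin n → Finset (ZMod p)} (h : IsSDPP A B)
    (hAB : ∀ i : Fin n, (n : ℝ) ^ (2 - δ) ≤ (((A i).card * (B i).card : ℕ) : ℝ)) :
    (n : ℝ) ^ (4 - δ) ≤ (∑ i, ((A i).card : ℝ)) * p := by
  haveI : Fact p.Prime := ⟨hp⟩
  have hnpos : (0 : ℝ) < n := by exact_mod_cast hn
  have hY : 0 < (n : ℝ) ^ (2 - δ) := Real.rpow_pos_of_pos hnpos _
  -- all sets are non-empty
  have hne : ∀ i : Fin n, (A i).Nonempty ∧ (B i).Nonempty := by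
    intro i
    have h1 : 0 < (A i).card * (B i).card := by
      have : (0 : ℝ) < (((A i).card * (B i).card : ℕ) : ℝ) := hY.trans_le (hAB i)
      exact_mod_cast this
    refine ⟨Finset.card_pos.1 (Nat.pos_of_ne_zero fun h0 => ?_),
      Finset.card_pos.1 (Nat.pos_of_ne_zero fun h0 => ?_)⟩
    · rw [h0, zero_mul] at h1; exact lt_irrefl 0 h1
    · rw [h0, mul_zero] at h1; exact lt_irrefl 0 h1
  have hBsum : ∑ i, (B i).card ≤ p := by
    have := h.sum_card_right_le fun i => (hne i).1
    rwa [ZMod.card] at this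
  have hBsumR : (∑ i, ((B i).card : ℝ)) ≤ p := by exact_mod_cast hBsum
  -- Cauchy–Schwarz
  have hCS := Real.sum_sqrt_mul_sqrt_le (Finset.univ : Finset (Fin n))
    (f := fun i => ((A i).card : ℝ)) (g := fun i => ((B i).card : ℝ))
    (fun i => Nat.cast_nonneg _) (fun i => Nat.cast_nonneg _)
  have hterm : ∀ i : Fin n, Real.sqrt ((n : ℝ) ^ (2 - δ)) ≤
      Real.sqrt ((A i).card : ℝ) * Real.sqrt ((B i).card : ℝ) := by
    intro i
    rw [← Real.sqrt_mul (Nat.cast_nonneg _)]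
    exact Real.sqrt_le_sqrt (by have := hAB i; push_cast at this; exact this)
  have hlow : (n : ℝ) * Real.sqrt ((n : ℝ) ^ (2 - δ)) ≤
      Real.sqrt (∑ i, ((A i).card : ℝ)) * Real.sqrt (∑ i, ((B i).card : ℝ)) := by
    have h1 : ∑ _i : Fin n, Real.sqrt ((n : ℝ) ^ (2 - δ)) ≤
        ∑ i : Fin n, Real.sqrt ((A i).card : ℝ) * Real.sqrt ((B i).card : ℝ) :=
      Finset.sum_le_sum fun i _ => hterm i
    rw [Finset.sum_const, Finset.card_univ, Fintype.card_fin, nsmul_eq_mul] at h1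
    exact h1.trans hCS
  have hA0 : 0 ≤ ∑ i, ((A i).card : ℝ) := Finset.sum_nonneg fun i _ => Nat.cast_nonneg _
  have hup : Real.sqrt (∑ i, ((A i).card : ℝ)) * Real.sqrt (∑ i, ((B i).card : ℝ)) ≤
      Real.sqrt (∑ i, ((A i).card : ℝ)) * Real.sqrt p :=
    mul_le_mul_of_nonneg_left (Real.sqrt_le_sqrt hBsumR) (Real.sqrt_nonneg _)
  have hchain := hlow.trans hup
  have hsq := pow_le_pow_left₀ (by positivity) hchain 2
  have e1 : ((n : ℝ) * Real.sqrt ((n : ℝ) ^ (2 - δ))) ^ 2 = (n : ℝ) ^ (4 - δ) := by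
    rw [mul_pow, Real.sq_sqrt hY.le, show (4 - δ : ℝ) = 2 + (2 - δ) by ring, Real.rpow_add hnpos,
      Real.rpow_two]
  have e2 : (Real.sqrt (∑ i, ((A i).card : ℝ)) * Real.sqrt p) ^ 2 = (∑ i, ((A i).card : ℝ)) * p := by
    rw [mul_pow, Real.sq_sqrt hA0, Real.sq_sqrt (Nat.cast_nonneg _)]
  rwa [e1, e2] at hsq

/-- **Pattern poverty of witnesses**: in a witness of slice `δ` at level `n ≥ 1` (prime
`p ≤ n^{2+δ}`, SDPP, `|Aᵢ||Bᵢ| ≥ n^{2-δ}`), a pattern `B₀` some translate of which lies inside EVERY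
`Bᵢ` has `|B₀| ≤ n^{3δ}` (`|B₀|·n^{4-δ} ≤ |B₀|·(Σ|Aᵢ|)·p ≤ p² ≤ n^{4+2δ}`).  By `isSDPP_swap` the same
holds for the `Aᵢ`.  For `δ → 0` the blocks share no common sub-structure beyond size `n^{o(1)}`
(no common long progression, subcube, …), while each block has size `≈ n^{1-δ/2}`. -/
theorem common_subshape_card_le_of_witness {n p : ℕ} (hp : p.Prime) (hn : 1 ≤ n) {δ : ℝ}
    {A B : Fin n → Finset (ZMod p)} (h : IsSDPP A B)
    (hpn : (p : ℝ) ≤ (n : ℝ) ^ (2 + δ))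
    (hAB : ∀ i : Fin n, (n : ℝ) ^ (2 - δ) ≤ (((A i).card * (B i).card : ℕ) : ℝ))
    (B₀ : Finset (ZMod p)) (u : Fin n → ZMod p) (hB₀ : ∀ i : Fin n, u i +ᵥ B₀ ⊆ B i) :
    (B₀.card : ℝ) ≤ (n : ℝ) ^ (3 * δ) := by
  haveI : Fact p.Prime := ⟨hp⟩
  have hnpos : (0 : ℝ) < n := by exact_mod_cast hn
  have hpack := sum_card_mul_card_le_of_subshape h Finset.univ B₀ u fun i _ => hB₀ i
  rw [ZMod.card] at hpack
  have hpackR : (∑ i, ((A i).card : ℝ)) * (B₀.card : ℝ) ≤ p := by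
    have : (((∑ i, (A i).card) * B₀.card : ℕ) : ℝ) ≤ p := by exact_mod_cast hpack
    push_cast at this
    exact this
  have hCS := rpow_le_sum_card_mul_of_witness hp hn h hAB
  have hp0 : (0 : ℝ) ≤ p := Nat.cast_nonneg _
  have hB0 : (0 : ℝ) ≤ B₀.card := Nat.cast_nonneg _
  -- `|B₀| · n^{4-δ} ≤ p²`
  have h1 : (B₀.card : ℝ) * (n : ℝ) ^ (4 - δ) ≤ (p : ℝ) * p := by
    calc (B₀.card : ℝ) * (n : ℝ) ^ (4 - δ) ≤ (B₀.card : ℝ) * ((∑ i, ((A i).card : ℝ)) * p) :=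
          mul_le_mul_of_nonneg_left hCS hB0
      _ = ((∑ i, ((A i).card : ℝ)) * (B₀.card : ℝ)) * p := by ring
      _ ≤ (p : ℝ) * p := mul_le_mul_of_nonneg_right hpackR hp0
  have h2 : (p : ℝ) * p ≤ (n : ℝ) ^ (3 * δ) * (n : ℝ) ^ (4 - δ) := by
    have h3 : (p : ℝ) * p ≤ (n : ℝ) ^ (2 + δ) * (n : ℝ) ^ (2 + δ) := mul_le_mul hpn hpn hp0 (by positivity)
    have h4 : (n : ℝ) ^ (2 + δ) * (n : ℝ) ^ (2 + δ) = (n : ℝ) ^ (3 * δ) * (n : ℝ) ^ (4 - δ) := by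
      rw [← Real.rpow_add hnpos, ← Real.rpow_add hnpos]; congr 1; ring
    rw [← h4]; exact h3
  exact le_of_mul_le_mul_right (h1.trans h2) (Real.rpow_pos_of_pos hnpos _)


end Shapes

end Summit.MatrixMultiplication.MatrixMultiplication.Theorems.PrimeTwoFamilies.Negative
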